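import Literature.Probability.RandomPlanarGeometry.StationaryAngleTimeScale
import Literature.Probability.Process.PathSpaceBorel
import Mathlib.Probability.Process.Adapted
import HarnessLib

/-!
# The coordinate filtration of the two-sided angle path space: freezing, adaptedness, the past filtration on `[0, ∞)`

Topic `Probability/RandomPlanarGeometry`; auxiliary definitions (`freezePath`, `pastFiltration`,
`coordProc`) and theorems, sequel of `WholePlaneSLE` / `StationaryAngleTimeScale`, shared by the
existence and the uniqueness halves of the proof of `IsStationaryAngleLaw.exists_unique`
(Miller–Sheffield (2017), Prop. 2.1). On `C(ℝ, ℝ)` with the coordinate filtration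
`ℱₜ = σ(x ↦ x(u), u ≤ t)` (`angleFiltration`):

* `freezePath b x = x(· ∧ b)` is `ℱ_b`-measurable into the Borel σ-algebra, so a Borel functional
  of the path which factors through `freezePath b` is `ℱ_b`-measurable
  (`measurable_angleFiltration_of_comp_freezePath`); in particular the martingale-problem
  increments `N^f_{s,t}` are `ℱ_t`-measurable (`measurable_angleIncrement_angleFiltration`), and
  they are additive over adjacent intervals (`angleIncrement_sub_angleIncrement`);
* `pastFiltration`, the filtration `(ℱ_u)_{u ≥ 0}` indexed by `ℝ≥0` (it contains the whole past
  `σ(x(r), r ≤ 0)` at time `0`), and the coordinate process `coordProc u x = x(u)` on `[0, ∞)`,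
  continuous, adapted and progressive.

## References

* J. Miller, S. Sheffield, *Imaginary geometry IV*, PTRF 169 (2017), arXiv:1302.4738, Prop. 2.1.
  [MillerSheffield2013]
* I. Karatzas, S. Shreve, *Brownian Motion and Stochastic Calculus* (1988), Ch. 5 §4.B.
  [KaratzasShreve1988]
-/

noncomputable section

open MeasureTheory ProbabilityTheory Filter Topology Set Function
open scoped NNReal ENNReal

namespace Literature.Probability.RandomPlanarGeometry

open scoped PathBorel
open Literature.Probability.Process

/-! ### Freezing a two-sided path after a time -/

section Freeze

/-- **Freezing a two-sided path after time `b`**: `freezePath b x (r) = x(r ∧ b)`. [folklore] -/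
def freezePath (b : ℝ) (x : C(ℝ, ℝ)) : C(ℝ, ℝ) :=
  x.comp ⟨fun r ↦ min r b, continuous_id.min continuous_const⟩

/-- Value of a frozen path. [folklore] -/
@[simp] theorem freezePath_apply (b : ℝ) (x : C(ℝ, ℝ)) (r : ℝ) : freezePath b x r = x (min r b) := rfl

/-- The evaluation at a time `j ≤ b` is `ℱ_b`-measurable. [folklore] -/
theorem measurable_eval_angleFiltration {j b : ℝ} (hjb : j ≤ b) :
    Measurable[angleFiltration b] fun x : C(ℝ, ℝ) ↦ x j := by
  refine measurable_iff_comap_le.2 ?_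
  change MeasurableSpace.comap (fun x : C(ℝ, ℝ) ↦ x j) inferInstance ≤
    ⨆ j ≤ b, MeasurableSpace.comap (fun x : C(ℝ, ℝ) ↦ x j) inferInstance
  exact le_iSup₂ (f := fun (j : ℝ) (_ : j ≤ b) ↦
    MeasurableSpace.comap (fun x : C(ℝ, ℝ) ↦ x j) inferInstance) j hjb

/-- **The freezing map is `ℱ_b`-measurable into the Borel σ-algebra** (all its coordinates are
coordinates at times `≤ b`). [folklore] -/
theorem measurable_freezePath (b : ℝ) : Measurable[angleFiltration b] (freezePath b) := by
  refine measurable_iff_comap_le.2 ?_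
  have hb : (PathBorel.instMeasurableSpaceTwoSidedRealPath : MeasurableSpace C(ℝ, ℝ)) =
      ⨆ a : ℝ, MeasurableSpace.comap (fun x : C(ℝ, ℝ) ↦ x a) inferInstance :=
    borel_continuousMap_eq_iSup_comap_eval
  conv_lhs => rw [hb, MeasurableSpace.comap_iSup]
  refine iSup_le fun a ↦ ?_
  rw [MeasurableSpace.comap_comp]
  have : (fun x : C(ℝ, ℝ) ↦ x a) ∘ freezePath b = fun x ↦ x (min a b) := by funext x; simp
  rw [this]
  exact measurable_iff_comap_le.1 (measurable_eval_angleFiltration (min_le_right a b))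

/-- A Borel functional of the path which only depends on the path frozen after `b` is
`ℱ_b`-measurable. [folklore] -/
theorem measurable_angleFiltration_of_comp_freezePath {E : Type*} [MeasurableSpace E]
    {F : C(ℝ, ℝ) → E} (hF : Measurable F) {b : ℝ} (h : ∀ x, F (freezePath b x) = F x) :
    Measurable[angleFiltration b] F := by
  have hcomp : F = F ∘ freezePath b := funext fun x ↦ (h x).symm
  rw [hcomp]
  exact hF.comp (measurable_freezePath b)

variable {κ : ℝ≥0} {ρ : ℝ} {f : ℝ → ℝ}

/-- The increment functional over `[s, t]` only depends on the path frozen after `t` (`s ≤ t`).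
[folklore] -/
theorem angleIncrement_freezePath {s t : ℝ} (hst : s ≤ t) (x : C(ℝ, ℝ)) :
    angleIncrement κ ρ f s t (freezePath t x) = angleIncrement κ ρ f s t x := by
  unfold angleIncrement
  simp only [freezePath_apply, min_self, min_eq_left hst]
  congr 1
  refine intervalIntegral.integral_congr fun u hu ↦ ?_
  rw [uIcc_of_le hst] at hu
  simp [min_eq_left hu.2]

/-- **The increment functionals `N^f_{s,t}` are `ℱ_t`-measurable** (`s ≤ t`; `f ∈ C²` supported in
`(0, 2π)`). [folklore] -/
theorem measurable_angleIncrement_angleFiltration (hf : ContDiff ℝ 2 f) (hsupp : tsupport f ⊆ Ioo 0 (2 * Real.pi))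
    {s t : ℝ} (hst : s ≤ t) : Measurable[angleFiltration t] (angleIncrement κ ρ f s t) :=
  measurable_angleFiltration_of_comp_freezePath (measurable_angleIncrement hf hsupp s t)
    (angleIncrement_freezePath hst)

/-- Additivity of the increments over adjacent intervals (continuous paths):
`N^f_{s,t} - N^f_{s,u} = N^f_{u,t}`. [folklore] -/
theorem angleIncrement_sub_angleIncrement (hf : ContDiff ℝ 2 f) (hsupp : tsupport f ⊆ Ioo 0 (2 * Real.pi))
    (s u t : ℝ) (x : C(ℝ, ℝ)) :
    angleIncrement κ ρ f s t x - angleIncrement κ ρ f s u x = angleIncrement κ ρ f u t x := by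
  unfold angleIncrement
  have hii : ∀ a b : ℝ, IntervalIntegrable (fun r ↦ angleGenerator κ ρ f (x r)) volume a b := fun a b ↦
    ((continuous_angleGenerator hf hsupp).comp x.continuous).intervalIntegrable a b
  rw [← intervalIntegral.integral_interval_sub_left (hii s t) (hii s u)]
  ring

/-- Continuity of the increment functional in the terminal time (continuous path). [folklore] -/
theorem continuous_angleIncrement_time (hf : ContDiff ℝ 2 f) (hsupp : tsupport f ⊆ Ioo 0 (2 * Real.pi))
    (s : ℝ) (x : C(ℝ, ℝ)) : Continuous fun t ↦ angleIncrement κ ρ f s t x := by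
  unfold angleIncrement
  refine ((hf.continuous.comp x.continuous).sub continuous_const).sub ?_
  have hc : Continuous fun r ↦ angleGenerator κ ρ f (x r) := (continuous_angleGenerator hf hsupp).comp x.continuous
  exact intervalIntegral.continuous_primitive (μ := volume) (fun a b ↦ hc.intervalIntegrable a b) s

end Freeze

/-! ### The past filtration indexed by `[0, ∞)` and the coordinate process -/

section Past

/-- **The past filtration on `[0, ∞)`**: `pastFiltration u = ℱ_u = σ(x(r), r ≤ u)` for `u ≥ 0`
(the whole two-sided past is in `pastFiltration 0`). [folklore] -/
def pastFiltration : Filtration ℝ≥0 (PathBorel.instMeasurableSpaceTwoSidedRealPath : MeasurableSpace C(ℝ, ℝ)) where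
  seq u := angleFiltration (u : ℝ)
  mono' _ _ h := angleFiltration.mono (NNReal.coe_le_coe.2 h)
  le' u := angleFiltration.le (u : ℝ)

/-- Unfolding of the past filtration. [folklore] -/
@[simp] theorem pastFiltration_apply (u : ℝ≥0) : pastFiltration u = angleFiltration (u : ℝ) := rfl

/-- **The coordinate process on `[0, ∞)`**: `coordProc u x = x(u)`. [folklore] -/
def coordProc (u : ℝ≥0) (x : C(ℝ, ℝ)) : ℝ := x u

/-- Unfolding of the coordinate process. [folklore] -/
@[simp] theorem coordProc_apply (u : ℝ≥0) (x : C(ℝ, ℝ)) : coordProc u x = x u := rfl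

/-- The coordinate process has continuous paths. [folklore] -/
theorem continuous_coordProc (x : C(ℝ, ℝ)) : Continuous fun u ↦ coordProc u x :=
  x.continuous.comp NNReal.continuous_coe

/-- The coordinate process is adapted to the past filtration. [folklore] -/
theorem adapted_coordProc : Adapted pastFiltration coordProc := fun _ ↦
  measurable_eval_angleFiltration le_rfl

/-- The coordinate process is strongly adapted. [folklore] -/
theorem stronglyAdapted_coordProc : StronglyAdapted pastFiltration coordProc := fun u ↦
  (adapted_coordProc u).stronglyMeasurable

/-- The coordinate process is progressive. [folklore] -/
theorem isStronglyProgressive_coordProc : IsStronglyProgressive pastFiltration coordProc :=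
  stronglyAdapted_coordProc.isStronglyProgressive_of_continuous continuous_coordProc

/-- The coordinate process is jointly measurable. [folklore] -/
theorem measurable_uncurry_coordProc : Measurable (uncurry coordProc) :=
  measurable_uncurry_of_continuous_of_measurable continuous_coordProc
    fun u ↦ (adapted_coordProc u).mono (angleFiltration.le _) le_rfl

end Past

end Literature.Probability.RandomPlanarGeometry
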